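import Literature.Probability.LatticeModels.PinningDomain
import Literature.Probability.LatticeModels.HalfPlaneUniqueness
import HarnessLib

/-!
# The pinning domain is determined from outside (Georgii–Higuchi 2000, Lemma 5.2)

Topic `Probability/LatticeModels`. The measurability hypothesis of the strong Markov property
for the exploration domain `pinDom` of `PinningDomain.lean` ("By maximality, `Γ` is determined
from outside", Georgii–Higuchi 2000, proofs of Lemmas 2.1, 2.2 and 5.2): if two configurations agree
off `pinDom m L ω` then they have the same domain (**`pinDom_eq_of_agree`**).

The proof compares the infinite structures `J(ω)` and `J(ω')` off the domain:
* a new `J`-site is an old one: its cluster either avoids the domain or first enters it next to an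
  upper crust site, which is in `J(ω)` (`mem_pinJ_of_mem_pinJ_of_agree`);
* an old `J`-site stays: its (infinite) cluster minus the (finite) domain is reached avoiding the
  domain, by **rerouting** every traversal of the domain through the upper crust of the
  corresponding *blob* (lattice-component of the unreachable set), which is `∗`-connected by the
  inner-boundary connectivity theorem (`exists_starWalk_latticeInnerBdry`, Timár) and the fold
  (`reroute`, `mem_pinJ_of_agree_of_mem_pinJ`);
hence the blocking sets, passability, reachability (reaching walks never enter the domain), the
crust and the domain agree.

## References

* H.-O. Georgii, Y. Higuchi, J. Math. Phys. 41 (2000), Lemma 5.2; Lemma 2.1 (proof) [GeorgiiHiguchi2000].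
* Á. Timár, Proc. AMS 141 (2013) [Timar2013].
-/

noncomputable section

open SimpleGraph Finset
open Literature.Probability.Percolation

namespace Literature.Probability.LatticeModels

variable {m L : ℕ} {ω : SpinConfig (Site 2)}

/-! ### The unreachable set and its blobs -/

/-- Unreachable sites are domain or crust sites. [folklore] -/
theorem mem_pinDom_or_pinCrust_of_not_mem_pinReach {z : Site 2} (hz : z ∉ pinReach m L ω) :
    z ∈ pinDom m L ω ∨ z ∈ pinCrust m L ω := by
  by_cases h : z ∈ pinCrust m L ω
  · exact Or.inr h
  · exact Or.inl (mem_pinDom_iff.2 ⟨hz, h⟩)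

/-- Domain and crust sites are unreachable. [folklore] -/
theorem not_mem_pinReach_of_mem_pinDom {z : Site 2} (hz : z ∈ pinDom m L ω) : z ∉ pinReach m L ω :=
  (mem_pinDom_iff.1 hz).1

/-- Crust sites are unreachable. [folklore] -/
theorem not_mem_pinReach_of_mem_pinCrust {z : Site 2} (hz : z ∈ pinCrust m L ω) : z ∉ pinReach m L ω :=
  fun h => hz.1 (mem_pinPass_of_mem_pinReach h)

/-- Unreachable sites lie in the box. [folklore] -/
theorem mem_box_of_not_mem_pinReach {z : Site 2} (hz : z ∉ pinReach m L ω) : z ∈ box 2 L := by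
  by_contra h; exact hz (mem_pinReach_of_not_mem_box h)

/-- The blob of `g`: the lattice-component of `g` in the unreachable set. [folklore] -/
def pinBlob (m L : ℕ) (ω : SpinConfig (Site 2)) (g : Site 2) : Set (Site 2) :=
  {v | ∃ w : (zdGraph 2).Walk g v, ∀ u ∈ w.support, u ∉ pinReach m L ω}

/-- Blob sites are unreachable. [folklore] -/
theorem not_mem_pinReach_of_mem_pinBlob {g v : Site 2} (hv : v ∈ pinBlob m L ω g) : v ∉ pinReach m L ω :=
  let ⟨w, hw⟩ := hv; hw v (Walk.end_mem_support w)

/-- The centre belongs to its blob. [folklore] -/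
theorem mem_pinBlob_self {g : Site 2} (hg : g ∉ pinReach m L ω) : g ∈ pinBlob m L ω g :=
  ⟨Walk.nil, fun u hu => by rw [Walk.support_nil, List.mem_singleton] at hu; exact hu ▸ hg⟩

/-- Blobs are closed under unreachable lattice neighbours. [folklore] -/
theorem mem_pinBlob_of_adj {g v u : Site 2} (hv : v ∈ pinBlob m L ω g) (hu : u ∉ pinReach m L ω)
    (hvu : (zdGraph 2).Adj v u) : u ∈ pinBlob m L ω g := by
  obtain ⟨w, hw⟩ := hv
  refine ⟨w.append (Walk.cons hvu Walk.nil), fun x hx => ?_⟩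
  rw [Walk.mem_support_append_iff, Walk.support_cons, Walk.support_nil, List.mem_cons, List.mem_singleton] at hx
  rcases hx with hx | hx | hx
  · exact hw x hx
  · exact hx ▸ hw v (Walk.end_mem_support w)
  · exact hx ▸ hu

/-- Blobs are closed under unreachable lattice walks. [folklore] -/
theorem mem_pinBlob_of_walk {g v u : Site 2} (hv : v ∈ pinBlob m L ω g) (w : (zdGraph 2).Walk v u)
    (hw : ∀ x ∈ w.support, x ∉ pinReach m L ω) : ∀ x ∈ w.support, x ∈ pinBlob m L ω g := by
  induction w with
  | nil => intro x hx; rw [Walk.support_nil, List.mem_singleton] at hx; exact hx ▸ hv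
  | cons hadj p ih =>
    rename_i a b c
    intro x hx
    rw [Walk.support_cons, List.mem_cons] at hx
    rcases hx with rfl | hx
    · exact hv
    · exact ih (mem_pinBlob_of_adj hv (hw b (by simp)) hadj) (fun y hy => hw y (by simp [hy])) x hx

/-- The blob as a finite set (inside `Λ_L`). [folklore] -/
def pinBlobF (m L : ℕ) (ω : SpinConfig (Site 2)) (g : Site 2) : Finset (Site 2) := by
  classical exact (box 2 L).filter fun v => v ∈ pinBlob m L ω g

/-- Membership in the finite blob. [folklore] -/
theorem mem_pinBlobF_iff {g v : Site 2} : v ∈ pinBlobF m L ω g ↔ v ∈ pinBlob m L ω g := by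
  classical
  unfold pinBlobF
  rw [mem_filter, and_iff_right_iff_imp]
  exact fun h => mem_box_of_not_mem_pinReach (not_mem_pinReach_of_mem_pinBlob h)

/-- A site outside the domain `∗`-adjacent to a blob site is outside the blob only if... precisely:
a domain site `∗`-adjacent to a blob site belongs to the blob. [folklore] -/
theorem mem_pinBlob_of_mem_pinDom_of_starAdj {g v e : Site 2} (hv : v ∈ pinBlob m L ω g)
    (he : e ∈ pinDom m L ω) (hev : zdStarGraph.Adj e v) : e ∈ pinBlob m L ω g := by
  by_cases hl : (zdGraph 2).Adj e v
  · exact mem_pinBlob_of_adj hv (not_mem_pinReach_of_mem_pinDom he) hl.symm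
  · obtain ⟨hd0, hd1⟩ := coords_ne_of_starAdj_not_adj hev hl
    have h' := hev
    rw [zdStarGraph_adj_iff] at h'
    obtain ⟨-, h0, h1⟩ := h'
    rw [abs_le] at h0 h1
    set c := mkSite (e 0) (v 1) with hc
    have hec : (zdGraph 2).Adj e c := by
      rcases lt_or_gt_of_ne hd1 with h | h
      · exact adj_of_stepKind (.up (show c 1 = e 1 + 1 by rw [hc, mkSite_apply_one]; omega) (by rw [hc, mkSite_apply_zero]))
      · exact adj_of_stepKind (.down (show e 1 = c 1 + 1 by rw [hc, mkSite_apply_one]; omega) (by rw [hc, mkSite_apply_zero]))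
    have hvc : (zdGraph 2).Adj v c := by
      rcases lt_or_gt_of_ne hd0 with h | h
      · exact adj_of_stepKind (.left (show v 0 = c 0 + 1 by rw [hc, mkSite_apply_zero]; omega) (by rw [hc, mkSite_apply_one]))
      · exact adj_of_stepKind (.right (show c 0 = v 0 + 1 by rw [hc, mkSite_apply_zero]; omega) (by rw [hc, mkSite_apply_one]))
    have hcR : c ∉ pinReach m L ω := not_mem_pinReach_of_adj_pinDom he hec
    exact mem_pinBlob_of_adj (mem_pinBlob_of_adj hv hcR hvc) (not_mem_pinReach_of_mem_pinDom he) hec.symm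

/-- **Attachment with a blob walk**: as `exists_attach`, recording that the crust site is joined
to `q` by an unreachable lattice walk (so it lies in the blob of `q`). [folklore] -/
theorem exists_attach' {q z : Site 2} (hq : q ∈ pinDom m L ω) (hz : z ∉ pinDom m L ω)
    (hqz : zdStarGraph.Adj q z) (hz1 : 0 ≤ z 1) :
    ∃ a ∈ pinCrust m L ω, 0 ≤ a 1 ∧ (z = a ∨ (zdGraph 2).Adj z a) ∧ a ∈ pinBlob m L ω q := by
  have hqB : q ∈ pinBlob m L ω q := mem_pinBlob_self (not_mem_pinReach_of_mem_pinDom hq)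
  by_cases hl : (zdGraph 2).Adj q z
  · have hzC := adj_pinDom_mem_pinCrust hq hz hl
    exact ⟨z, hzC, hz1, Or.inl rfl, mem_pinBlob_of_adj hqB (not_mem_pinReach_of_mem_pinCrust hzC) hl⟩
  obtain ⟨hd0, hd1⟩ := coords_ne_of_starAdj_not_adj hqz hl
  have hqz' := hqz
  rw [zdStarGraph_adj_iff] at hqz'
  obtain ⟨-, h0, h1⟩ := hqz'
  rw [abs_le] at h0 h1
  set c := mkSite (q 0) (z 1) with hc
  have hqc : (zdGraph 2).Adj q c := by
    rcases lt_or_gt_of_ne hd1 with h | h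
    · exact adj_of_stepKind (.up (show c 1 = q 1 + 1 by rw [hc, mkSite_apply_one]; omega) (by rw [hc, mkSite_apply_zero]))
    · exact adj_of_stepKind (.down (show q 1 = c 1 + 1 by rw [hc, mkSite_apply_one]; omega) (by rw [hc, mkSite_apply_zero]))
  have hzc : (zdGraph 2).Adj z c := by
    rcases lt_or_gt_of_ne hd0 with h | h
    · exact adj_of_stepKind (.left (show z 0 = c 0 + 1 by rw [hc, mkSite_apply_zero]; omega) (by rw [hc, mkSite_apply_one]))
    · exact adj_of_stepKind (.right (show c 0 = z 0 + 1 by rw [hc, mkSite_apply_zero]; omega) (by rw [hc, mkSite_apply_one]))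
  have hcR : c ∉ pinReach m L ω := not_mem_pinReach_of_adj_pinDom hq hqc
  have hcB : c ∈ pinBlob m L ω q := mem_pinBlob_of_adj hqB hcR hqc
  by_cases hcC : c ∈ pinCrust m L ω
  · exact ⟨c, hcC, by simp [hc]; exact hz1, Or.inr hzc, hcB⟩
  · have hcD : c ∈ pinDom m L ω := mem_pinDom_iff.2 ⟨hcR, hcC⟩
    have hzC := adj_pinDom_mem_pinCrust hcD hz hzc.symm
    exact ⟨z, hzC, hz1, Or.inl rfl, mem_pinBlob_of_adj hcB (not_mem_pinReach_of_mem_pinCrust hzC) hzc.symm⟩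

/-! ### Lattice walks outside a box -/

/-- **Two sites outside a box are joined by a lattice walk outside the box** (right to a far
column or up to a far row first, according to which coordinate is outside). [folklore] -/
theorem exists_walk_outside_box {N : ℕ} {a b : Site 2} (ha : a ∉ box 2 N) (hb : b ∉ box 2 N) :
    ∃ w : (zdGraph 2).Walk a b, ∀ v ∈ w.support, v ∉ box 2 N := by
  -- the far corner `T = (C, R)`
  set C : ℤ := N + 1 + |a 0| + |b 0| with hC
  set R : ℤ := N + 1 + |a 1| + |b 1| with hR
  have key : ∀ {a : Site 2}, a ∉ box 2 N → |a 0| ≤ C - N - 1 → |a 1| ≤ R - N - 1 →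
      ∃ w : (zdGraph 2).Walk a (mkSite C R), ∀ v ∈ w.support, v ∉ box 2 N := by
    intro a ha ha0 ha1
    rw [abs_le] at ha0 ha1
    have hout : ∀ v : Site 2, (N : ℤ) < |v 0| ∨ (N : ℤ) < |v 1| → v ∉ box 2 N := by
      intro v hv hvb
      rw [mem_box, Fin.forall_fin_two] at hvb
      rcases hv with hv | hv <;> rw [lt_abs] at hv <;> omega
    by_cases h1 : (N : ℤ) < |a 1|
    · -- row outside: right to column `C`, then up to row `R`
      set k : ℕ := (C - a 0).toNat with hk
      set k' : ℕ := (R - a 1).toNat with hk'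
      have hk0 : (k : ℤ) = C - a 0 := by rw [hk, Int.toNat_of_nonneg (by omega)]
      have hk'0 : (k' : ℤ) = R - a 1 := by rw [hk', Int.toNat_of_nonneg (by omega)]
      set mid := (fun w : Site 2 => w + Pi.single 0 1)^[k] a with hmid
      have hmid0 : mid 0 = C := by rw [hmid, (iterate_right_apply a k).1, hk0]; ring
      have hmid1 : mid 1 = a 1 := by rw [hmid, (iterate_right_apply a k).2]
      have hend : (fun w : Site 2 => w + Pi.single 1 1)^[k'] mid = mkSite C R := by
        ext i; fin_cases i
        · change ((fun w : Site 2 => w + Pi.single 1 1)^[k'] mid) 0 = C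
          rw [Zhang.iterate_add_apply]; simp [hmid0]
        · change ((fun w : Site 2 => w + Pi.single 1 1)^[k'] mid) 1 = R
          rw [Zhang.iterate_add_apply]; simp [hmid1, hk'0]
      refine ⟨(Zhang.stepRun (Pi.single 0 1) Zhang.adj_add_unitStep.1 a k).append
        ((Zhang.stepRun (Pi.single 1 1) Zhang.adj_add_unitStep.2.2.1 mid k').copy rfl hend), fun v hv => ?_⟩
      rw [Walk.mem_support_append_iff, Walk.support_copy, mem_support_rightRun, mem_support_upRun] at hv
      rcases hv with hv | hv
      · exact hout v (Or.inr (by rw [hv.2.2]; exact h1))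
      · exact hout v (Or.inl (by rw [hv.1, hmid0, lt_abs]; left; omega))
    · -- row inside, so the column is outside: up to row `R`, then right to column `C`
      have h0 : (N : ℤ) < |a 0| := by
        by_contra h
        push Not at h h1
        rw [abs_le] at h h1
        exact ha (mem_box.2 fun i => by fin_cases i <;> assumption)
      set k' : ℕ := (R - a 1).toNat with hk'
      set k : ℕ := (C - a 0).toNat with hk
      have hk0 : (k : ℤ) = C - a 0 := by rw [hk, Int.toNat_of_nonneg (by omega)]
      have hk'0 : (k' : ℤ) = R - a 1 := by rw [hk', Int.toNat_of_nonneg (by omega)]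
      set mid := (fun w : Site 2 => w + Pi.single 1 1)^[k'] a with hmid
      have hmid0 : mid 0 = a 0 := by rw [hmid, Zhang.iterate_add_apply]; simp
      have hmid1 : mid 1 = R := by rw [hmid, Zhang.iterate_add_apply]; simp [hk'0]
      have hend : (fun w : Site 2 => w + Pi.single 0 1)^[k] mid = mkSite C R := by
        ext i; fin_cases i
        · change ((fun w : Site 2 => w + Pi.single 0 1)^[k] mid) 0 = C
          rw [(iterate_right_apply mid k).1, hmid0, hk0]; ring
        · change ((fun w : Site 2 => w + Pi.single 0 1)^[k] mid) 1 = R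
          rw [(iterate_right_apply mid k).2, hmid1]
      refine ⟨(Zhang.stepRun (Pi.single 1 1) Zhang.adj_add_unitStep.2.2.1 a k').append
        ((Zhang.stepRun (Pi.single 0 1) Zhang.adj_add_unitStep.1 mid k).copy rfl hend), fun v hv => ?_⟩
      rw [Walk.mem_support_append_iff, Walk.support_copy, mem_support_upRun, mem_support_rightRun] at hv
      rcases hv with hv | hv
      · exact hout v (Or.inl (by rw [hv.1]; exact h0))
      · exact hout v (Or.inr (by rw [hv.2.2, hmid1, lt_abs]; left; omega))
  obtain ⟨wa, hwa⟩ := key ha (by have := abs_nonneg (b 0); omega) (by have := abs_nonneg (b 1); omega)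
  obtain ⟨wb, hwb⟩ := key hb (by have := abs_nonneg (a 0); omega) (by have := abs_nonneg (a 1); omega)
  refine ⟨wa.append wb.reverse, fun v hv => ?_⟩
  rw [Walk.mem_support_append_iff, Walk.support_reverse, List.mem_reverse] at hv
  rcases hv with hv | hv
  · exact hwa v hv
  · exact hwb v hv

/-! ### The complement of a blob is lattice-connected -/

/-- A site outside a blob is joined to a site outside the box by a lattice walk avoiding the blob. [folklore] -/
theorem exists_walk_avoiding_pinBlob {g a : Site 2} (ha : a ∉ pinBlob m L ω g) :
    ∃ (o : Site 2) (w : (zdGraph 2).Walk a o), o ∉ box 2 L ∧ ∀ v ∈ w.support, v ∉ pinBlob m L ω g := by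
  classical
  -- from a reachable site: along its reaching walk to the outside, then to the outside of the box
  have hreach : ∀ {r : Site 2}, r ∈ pinReach m L ω →
      ∃ (o : Site 2) (w : (zdGraph 2).Walk r o), o ∉ box 2 L ∧ ∀ v ∈ w.support, v ∉ pinBlob m L ω g := by
    rintro r ⟨y, hy, w, hw⟩
    refine ⟨y, w.reverse, hy, fun v hv hvB => not_mem_pinReach_of_mem_pinBlob hvB ?_⟩
    rw [Walk.support_reverse, List.mem_reverse] at hv
    exact mem_pinReach_of_mem_support hy w hw hv
  by_cases haR : a ∈ pinReach m L ω
  · exact hreach haR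
  -- `a` unreachable outside the blob: go up until the first reachable site; the unreachable prefix stays in the blob of `a`, disjoint from the blob of `g`
  set k : ℕ := ((L : ℤ) + 1 - a 1).toNat with hk
  have htop : (fun w : Site 2 => w + Pi.single 1 1)^[k] a ∉ box 2 L := by
    intro h; have := (mem_box.1 h 1).2; rw [Zhang.iterate_add_apply] at this; simp at this; omega
  obtain ⟨b, r, W₀, hbr, hr, -, hW₀, -⟩ := exists_split_first_mem' (S := pinReach m L ω)
    (Zhang.stepRun (Pi.single 1 1) Zhang.adj_add_unitStep.2.2.1 a k) haR ⟨_, Walk.end_mem_support _, mem_pinReach_of_not_mem_box htop⟩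
  obtain ⟨o, w', ho, hw'⟩ := hreach hr
  refine ⟨o, (W₀.append (Walk.cons hbr Walk.nil)).append w', ho, fun v hv hvB => ?_⟩
  rw [Walk.mem_support_append_iff, Walk.mem_support_append_iff, Walk.support_cons, Walk.support_nil, List.mem_cons,
    List.mem_singleton] at hv
  rcases hv with (hv | hv | hv) | hv
  · -- `v` on the unreachable prefix: then `a` would be in the blob of `g`
    apply ha
    have hvBa := mem_pinBlob_of_walk hvB (W₀.takeUntil v hv).reverse (fun x hx => hW₀ x (by
      rw [Walk.support_reverse, List.mem_reverse] at hx; exact Walk.support_takeUntil_subset_support W₀ hv hx))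
    exact hvBa a (Walk.end_mem_support _)
  · -- `v = b`, the last unreachable vertex: same argument
    apply ha
    rw [hv] at hvB
    have hvBa := mem_pinBlob_of_walk hvB W₀.reverse (fun x hx => hW₀ x (by
      rw [Walk.support_reverse, List.mem_reverse] at hx; exact hx))
    exact hvBa a (Walk.end_mem_support _)
  · exact not_mem_pinReach_of_mem_pinBlob hvB (hv ▸ hr)
  · exact hw' v hv hvB

/-- **The complement of a blob is lattice-connected.** [folklore] -/
theorem exists_walk_compl_pinBlob {g a b : Site 2} (ha : a ∉ pinBlob m L ω g) (hb : b ∉ pinBlob m L ω g) :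
    ∃ w : (zdGraph 2).Walk a b, ∀ v ∈ w.support, v ∉ pinBlob m L ω g := by
  obtain ⟨oa, wa, hoa, hwa⟩ := exists_walk_avoiding_pinBlob ha
  obtain ⟨ob, wb, hob, hwb⟩ := exists_walk_avoiding_pinBlob hb
  obtain ⟨wo, hwo⟩ := exists_walk_outside_box hoa hob
  refine ⟨(wa.append wo).append wb.reverse, fun v hv => ?_⟩
  rw [Walk.mem_support_append_iff, Walk.mem_support_append_iff, Walk.support_reverse, List.mem_reverse] at hv
  rcases hv with (hv | hv) | hv
  · exact hwa v hv
  · exact fun h => hwo v hv (mem_box_of_not_mem_pinReach (not_mem_pinReach_of_mem_pinBlob h))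
  · exact hwb v hv

/-- **The blob is lattice-connected through itself.** [folklore] -/
theorem exists_walk_in_pinBlob {g a b : Site 2} (ha : a ∈ pinBlob m L ω g) (hb : b ∈ pinBlob m L ω g) :
    ∃ w : (zdGraph 2).Walk a b, ∀ v ∈ w.support, v ∈ pinBlob m L ω g := by
  obtain ⟨wa, hwa⟩ := ha
  obtain ⟨wb, hwb⟩ := hb
  have hg : g ∈ pinBlob m L ω g := mem_pinBlob_self (hwa g (Walk.start_mem_support wa))
  refine ⟨wa.reverse.append wb, fun v hv => ?_⟩
  rw [Walk.mem_support_append_iff, Walk.support_reverse, List.mem_reverse] at hv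
  rcases hv with hv | hv
  · exact mem_pinBlob_of_walk hg wa hwa v hv
  · exact mem_pinBlob_of_walk hg wb hwb v hv

/-- The inner boundary of a blob consists of crust sites. [folklore] -/
theorem mem_pinCrust_of_mem_innerBoundary_pinBlobF {g h : Site 2} (hh : h ∈ innerBoundary (zdGraph 2) (pinBlobF m L ω g)) :
    h ∈ pinCrust m L ω := by
  rw [mem_innerBoundary_iff] at hh
  obtain ⟨hhB, y, hyB, hhy⟩ := hh
  rw [mem_pinBlobF_iff] at hhB hyB
  have hyR : y ∈ pinReach m L ω := by
    by_contra hyR; exact hyB (mem_pinBlob_of_adj hhB hyR hhy)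
  rcases mem_pinDom_or_pinCrust_of_not_mem_pinReach (not_mem_pinReach_of_mem_pinBlob hhB) with h | h
  · exact absurd hyR (not_mem_pinReach_of_adj_pinDom h hhy)
  · exact h

/-- Crust sites of a blob are inner boundary sites. [folklore] -/
theorem mem_innerBoundary_pinBlobF_of_mem_pinCrust {g k : Site 2} (hk : k ∈ pinCrust m L ω) (hkB : k ∈ pinBlob m L ω g) :
    k ∈ innerBoundary (zdGraph 2) (pinBlobF m L ω g) := by
  rw [mem_innerBoundary_iff, mem_pinBlobF_iff]
  obtain ⟨-, y, hy, hky⟩ := hk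
  exact ⟨hkB, y, fun h => not_mem_pinReach_of_mem_pinBlob (mem_pinBlobF_iff.1 h) hy, hky⟩

/-- **The crust walk**: two upper crust sites of a blob are joined by a `∗`-walk of upper crust
sites (inner-boundary connectivity of the blob, folded into the upper half-plane) — in particular of
`J`-sites off the domain. [cite: GeorgiiHiguchi2000, Lemma 5.2 (proof: "`+∗`connected … to `I^{+∗}_up`")] -/
theorem exists_crustWalk {g k₁ k₂ : Site 2} (hk₁ : k₁ ∈ pinCrust m L ω) (hk₂ : k₂ ∈ pinCrust m L ω)
    (hk₁B : k₁ ∈ pinBlob m L ω g) (hk₂B : k₂ ∈ pinBlob m L ω g) (hk₁1 : 0 ≤ k₁ 1) (hk₂1 : 0 ≤ k₂ 1) :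
    ∃ q : zdStarGraph.Walk k₁ k₂, ∀ v ∈ q.support, v ∈ pinCrust m L ω ∧ 0 ≤ v 1 := by
  obtain ⟨q, hq⟩ := exists_starWalk_latticeInnerBdry (A := pinBlobF m L ω g)
    (fun a ha b hb => by
      obtain ⟨w, hw⟩ := exists_walk_in_pinBlob (mem_pinBlobF_iff.1 ha) (mem_pinBlobF_iff.1 hb)
      exact ⟨w, fun z hz => mem_pinBlobF_iff.2 (hw z hz)⟩)
    (fun a ha b hb => by
      obtain ⟨w, hw⟩ := exists_walk_compl_pinBlob (g := g) (fun h => ha (mem_pinBlobF_iff.2 h)) (fun h => hb (mem_pinBlobF_iff.2 h))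
      exact ⟨w, fun z hz h => hw z hz (mem_pinBlobF_iff.1 h)⟩)
    (mem_innerBoundary_pinBlobF_of_mem_pinCrust hk₁ hk₁B) (mem_innerBoundary_pinBlobF_of_mem_pinCrust hk₂ hk₂B)
  refine ⟨(q.map starFoldHom).copy (foldSite_of_nonneg hk₁1) (foldSite_of_nonneg hk₂1), fun v hv => ?_⟩
  rw [Walk.support_copy] at hv
  obtain ⟨y, hy, rfl⟩ := (mem_support_map_iff' _ q v).1 hv
  have hyC := mem_pinCrust_of_mem_innerBoundary_pinBlobF (hq y hy)
  refine ⟨?_, by rw [starFoldHom_apply, foldSite_apply_one]; exact abs_nonneg _⟩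
  rw [starFoldHom_apply]
  rcases foldSite_eq_or y with h | h <;> rw [h]
  · exact hyC
  · exact pinCrust_Rf_iff.2 hyC

/-! ### Rerouting `J`-walks off the domain -/

/-- A one-or-zero step `∗`-walk from `a = k ∨ a ∼ k`. [folklore] -/
def orStep {a k : Site 2} (h : a = k ∨ (zdGraph 2).Adj a k) : zdStarGraph.Walk a k := by
  classical
  exact if e : a = k then (Walk.nil : zdStarGraph.Walk a a).copy rfl e
    else Walk.cons (zdGraph_le_zdStarGraph (h.resolve_left e)) Walk.nil

/-- Vertices of `orStep`. [folklore] -/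
theorem mem_support_orStep {a k v : Site 2} (h : a = k ∨ (zdGraph 2).Adj a k) (hv : v ∈ (orStep h).support) :
    v = a ∨ v = k := by
  classical
  unfold orStep at hv
  split_ifs at hv with e
  · rw [Walk.support_copy, Walk.support_nil, List.mem_singleton] at hv; exact Or.inl hv
  · rw [Walk.support_cons, Walk.support_nil, List.mem_cons, List.mem_singleton] at hv; exact hv

/-- Blobs are nested along membership. [folklore] -/
theorem pinBlob_subset_of_mem {g g' : Site 2} (hg' : g' ∈ pinBlob m L ω g) : pinBlob m L ω g' ⊆ pinBlob m L ω g := by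
  rintro v ⟨w, hw⟩
  exact mem_pinBlob_of_walk hg' w hw v (Walk.end_mem_support w)

/-- **Rerouting**: a `∗`-walk of `J`-sites between two sites off the domain can be replaced by a
`∗`-walk of `J`-sites avoiding the domain (induction on the number of domain vertices: the first
traversal of a blob is replaced by a crust walk). [cite: GeorgiiHiguchi2000, Lemma 5.2 (proof)] -/
theorem reroute : ∀ (n : ℕ) {p q : Site 2} (W : zdStarGraph.Walk p q),
    (∃ T : Finset (Site 2), T.card ≤ n ∧ ∀ v ∈ W.support, v ∈ pinDom m L ω → v ∈ T) →
    (∀ v ∈ W.support, v ∈ pinJ m ω) → p ∉ pinDom m L ω → q ∉ pinDom m L ω →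
    ∃ W' : zdStarGraph.Walk p q, ∀ v ∈ W'.support, v ∈ pinJ m ω ∧ v ∉ pinDom m L ω := by
  classical
  intro n
  induction n with
  | zero =>
    rintro p q W ⟨T, hT, hTW⟩ hJ hp hq
    refine ⟨W, fun v hv => ⟨hJ v hv, fun hvD => ?_⟩⟩
    have : v ∈ T := hTW v hv hvD
    rw [Finset.card_eq_zero.1 (Nat.le_zero.1 hT)] at this
    simp at this
  | succ n ih =>
    rintro p q W ⟨T, hT, hTW⟩ hJ hp hq
    by_cases hex : ∃ v ∈ W.support, v ∈ (↑(pinDom m L ω) : Set (Site 2))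
    swap
    · push Not at hex
      exact ⟨W, fun v hv => ⟨hJ v hv, fun h => hex v hv (Finset.mem_coe.2 h)⟩⟩
    -- first domain vertex `g`, entered from `a`
    obtain ⟨a, g, W₀, hag, hgD, hgW, hW₀D, hW₀W⟩ := exists_split_first_mem' (S := (↑(pinDom m L ω) : Set (Site 2))) W
      (fun h => hp (Finset.mem_coe.1 h)) hex
    have hgD' : g ∈ pinDom m L ω := Finset.mem_coe.1 hgD
    have haW : a ∈ W.support := hW₀W a (Walk.end_mem_support W₀)
    have haD : a ∉ pinDom m L ω := fun h => hW₀D a (Walk.end_mem_support W₀) (Finset.mem_coe.2 h)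
    have ha1 : 0 ≤ a 1 := (pinJ_props (hJ a haW)).2.1
    obtain ⟨ka, hkaC, hka1, haka, hkaB⟩ := exists_attach' hgD' haD hag.symm ha1
    have hgB : g ∈ pinBlob m L ω g := mem_pinBlob_self (not_mem_pinReach_of_mem_pinDom hgD')
    -- the walk up to the attachment, off the domain and in `J`
    have hpre : ∀ v ∈ (W₀.append (orStep haka)).support, v ∈ pinJ m ω ∧ v ∉ pinDom m L ω := by
      intro v hv
      rw [Walk.mem_support_append_iff] at hv
      rcases hv with hv | hv
      · exact ⟨hJ v (hW₀W v hv), fun h => hW₀D v hv (Finset.mem_coe.2 h)⟩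
      · rcases mem_support_orStep haka hv with rfl | rfl
        · exact ⟨hJ _ haW, haD⟩
        · exact ⟨mem_pinJ_of_mem_pinCrust hkaC hka1, not_mem_pinDom_of_mem_pinCrust hkaC⟩
    have hcrust : ∀ {k : Site 2} (ρ : zdStarGraph.Walk ka k), (∀ v ∈ ρ.support, v ∈ pinCrust m L ω ∧ 0 ≤ v 1) →
        ∀ v ∈ ρ.support, v ∈ pinJ m ω ∧ v ∉ pinDom m L ω := fun ρ hρ v hv =>
      ⟨mem_pinJ_of_mem_pinCrust (hρ v hv).1 (hρ v hv).2, not_mem_pinDom_of_mem_pinCrust (hρ v hv).1⟩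
    by_cases hqB : q ∈ pinBlob m L ω g
    · -- `q` itself is an upper crust site of the blob: finish with a crust walk
      have hqC : q ∈ pinCrust m L ω := by
        rcases mem_pinDom_or_pinCrust_of_not_mem_pinReach (not_mem_pinReach_of_mem_pinBlob hqB) with h | h
        · exact absurd h hq
        · exact h
      obtain ⟨ρ, hρ⟩ := exists_crustWalk hkaC hqC hkaB hqB hka1 (pinJ_props (hJ q (Walk.end_mem_support W))).2.1
      refine ⟨(W₀.append (orStep haka)).append ρ, fun v hv => ?_⟩
      rw [Walk.mem_support_append_iff] at hv
      rcases hv with hv | hv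
      · exact hpre v hv
      · exact hcrust ρ hρ v hv
    · -- last blob vertex `gs`, left to `e`
      have hgWr : g ∈ W.reverse.support := by rw [Walk.support_reverse, List.mem_reverse]; exact hgW
      obtain ⟨e, gs, W₁, hegs, hgsB, hgsWr, hW₁B, hW₁W⟩ := exists_split_first_mem' (S := pinBlob m L ω g) W.reverse hqB ⟨g, hgWr, hgB⟩
      have hW₁W' : ∀ y ∈ W₁.support, y ∈ W.support := fun y hy => by
        have := hW₁W y hy; rwa [Walk.support_reverse, List.mem_reverse] at this
      have hgsW : gs ∈ W.support := by rwa [Walk.support_reverse, List.mem_reverse] at hgsWr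
      have heW : e ∈ W.support := hW₁W' e (Walk.end_mem_support W₁)
      have heB : e ∉ pinBlob m L ω g := hW₁B e (Walk.end_mem_support W₁)
      have heD : e ∉ pinDom m L ω := fun h => heB (mem_pinBlob_of_mem_pinDom_of_starAdj hgsB h hegs)
      have he1 : 0 ≤ e 1 := (pinJ_props (hJ e heW)).2.1
      -- the attachment `ke` of `e` to the upper crust of the blob
      obtain ⟨ke, hkeC, hke1, heke, hkeB⟩ : ∃ ke ∈ pinCrust m L ω, 0 ≤ ke 1 ∧ (e = ke ∨ zdStarGraph.Adj e ke) ∧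
          ke ∈ pinBlob m L ω g := by
        rcases mem_pinDom_or_pinCrust_of_not_mem_pinReach (not_mem_pinReach_of_mem_pinBlob hgsB) with h | h
        · obtain ⟨ke, hkeC, hke1, heke, hkeB⟩ := exists_attach' h heD hegs.symm he1
          exact ⟨ke, hkeC, hke1, heke.imp id fun h' => zdGraph_le_zdStarGraph h', pinBlob_subset_of_mem hgsB hkeB⟩
        · exact ⟨gs, h, (pinJ_props (hJ gs hgsW)).2.1, Or.inr hegs, hgsB⟩
      obtain ⟨ρ, hρ⟩ := exists_crustWalk hkaC hkeC hkaB hkeB hka1 hke1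
      -- induction on the rest `e → q`, whose domain vertices lie in `T.erase g`
      have hgT : g ∈ T := hTW g hgW hgD'
      have hcard' : (T.erase g).card ≤ n := by rw [Finset.card_erase_of_mem hgT]; omega
      obtain ⟨W₂, hW₂⟩ := ih W₁.reverse ⟨T.erase g, hcard', fun v hv hvD => by
          rw [Walk.support_reverse, List.mem_reverse] at hv
          refine Finset.mem_erase.2 ⟨fun h => hW₁B v hv (h ▸ hgB), hTW v (hW₁W' v hv) hvD⟩⟩
        (fun v hv => hJ v (hW₁W' v (by rwa [Walk.support_reverse, List.mem_reverse] at hv))) heD hq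
      -- the step from `ke` back to `e`
      have hstep : ∃ st : zdStarGraph.Walk ke e, ∀ v ∈ st.support, v = ke ∨ v = e := by
        rcases heke with h | h
        · exact ⟨(Walk.nil : zdStarGraph.Walk ke ke).copy rfl h.symm, fun v hv => by
            rw [Walk.support_copy, Walk.support_nil, List.mem_singleton] at hv; exact Or.inl hv⟩
        · exact ⟨Walk.cons h.symm Walk.nil, fun v hv => by simpa using hv⟩
      obtain ⟨st, hst⟩ := hstep
      refine ⟨(((W₀.append (orStep haka)).append ρ).append st).append W₂, fun v hv => ?_⟩
      simp only [Walk.mem_support_append_iff] at hv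
      rcases hv with (((hv | hv) | hv) | hv) | hv
      · exact hpre v ((Walk.mem_support_append_iff _ _).2 (Or.inl hv))
      · exact hpre v ((Walk.mem_support_append_iff _ _).2 (Or.inr hv))
      · exact hcrust ρ hρ v hv
      · rcases hst v hv with rfl | rfl
        · exact ⟨mem_pinJ_of_mem_pinCrust hkeC hke1, not_mem_pinDom_of_mem_pinCrust hkeC⟩
        · exact ⟨hJ _ heW, heD⟩
      · exact hW₂ v hv

/-! ### Agreement off the domain -/

section Agree

variable {ω' : SpinConfig (Site 2)}

/-- `U` agrees off the domain. [folklore] -/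
theorem pinU_agree (hagree : ∀ v, v ∉ pinDom m L ω → ω' v = ω v) {z : Site 2} (hz : z ∉ pinDom m L ω) :
    z ∈ pinU m ω' ↔ z ∈ pinU m ω := by
  simp only [pinU, Set.mem_inter_iff, mem_spinSites, hagree z hz]

/-- Every site of an infinite cluster has an infinite cluster. [folklore] -/
theorem mem_pinJ_of_mem_cluster {O : SpinConfig (Site 2)} {z y : Site 2} (hz : z ∈ pinJ m O)
    (hy : y ∈ siteCluster zdStarGraph (pinU m O) z) : y ∈ pinJ m O := by
  change (siteCluster zdStarGraph (pinU m O) y).Infinite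
  rw [siteCluster_eq_of_mem ((mem_siteCluster_self_iff _ _ _).2 (mem_of_mem_siteCluster hy)) hy]
  exact hz

/-- **A new `J`-site off the domain is an old one.** [cite: GeorgiiHiguchi2000, Lemma 5.2 (proof: "determined from outside")] -/
theorem mem_pinJ_of_mem_pinJ_of_agree (hagree : ∀ v, v ∉ pinDom m L ω → ω' v = ω v) {z : Site 2}
    (hz : z ∉ pinDom m L ω) (hz' : z ∈ pinJ m ω') : z ∈ pinJ m ω := by
  classical
  set C' := siteCluster zdStarGraph (pinU m ω') z with hC'
  have hzU' : z ∈ pinU m ω' := mem_pinU_of_mem_pinJ hz'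
  have hzU : z ∈ pinU m ω := (pinU_agree hagree hz).1 hzU'
  have hzself : z ∈ siteCluster zdStarGraph (pinU m ω) z := (mem_siteCluster_self_iff _ _ _).2 hzU
  by_cases hex : ∃ g ∈ C', g ∈ (↑(pinDom m L ω) : Set (Site 2))
  · obtain ⟨g, hgC', hgD⟩ := hex
    obtain ⟨w, hw⟩ := exists_walk_in_siteCluster ((mem_siteCluster_self_iff _ _ _).2 hzU') hgC'
    obtain ⟨a, g', W₀, hag', hg'D, -, hW₀D, hW₀w⟩ := exists_split_first_mem' (S := (↑(pinDom m L ω) : Set (Site 2))) w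
      (fun h => hz (Finset.mem_coe.1 h)) ⟨g, Walk.end_mem_support w, hgD⟩
    have haD : a ∉ pinDom m L ω := fun h => hW₀D a (Walk.end_mem_support W₀) (Finset.mem_coe.2 h)
    have haU : a ∈ pinU m ω := (pinU_agree hagree haD).1 (mem_of_mem_siteCluster (hw a (hW₀w a (Walk.end_mem_support W₀))))
    have haJ : a ∈ pinJ m ω := mem_pinJ_of_adj_pinDom (Finset.mem_coe.1 hg'D) haD hag'.symm haU
    -- `z` is joined to `a` inside `U(ω)` off the domain
    have hreach : (siteOpenGraph zdStarGraph (pinU m ω)).Reachable z a :=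
      reachable_siteOpenGraph_of_walk W₀ fun v hv =>
        (pinU_agree hagree (fun h => hW₀D v hv (Finset.mem_coe.2 h))).1 (mem_of_mem_siteCluster (hw v (hW₀w v hv)))
    have haz : a ∈ siteCluster zdStarGraph (pinU m ω) z := ⟨hzU, haU, hreach⟩
    change (siteCluster zdStarGraph (pinU m ω) z).Infinite
    rw [← siteCluster_eq_of_mem ((mem_siteCluster_self_iff _ _ _).2 haU) haz]
    exact haJ
  · push Not at hex
    refine Set.Infinite.mono (fun y hy => ?_) hz'
    obtain ⟨w, hw⟩ := exists_walk_in_siteCluster ((mem_siteCluster_self_iff _ _ _).2 hzU') hy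
    have hreach : (siteOpenGraph zdStarGraph (pinU m ω)).Reachable z y :=
      reachable_siteOpenGraph_of_walk w fun v hv =>
        (pinU_agree hagree (fun h => hex v (hw v hv) (Finset.mem_coe.2 h))).1 (mem_of_mem_siteCluster (hw v hv))
    exact ⟨hzU, (pinU_agree hagree (fun h => hex y hy (Finset.mem_coe.2 h))).1 (mem_of_mem_siteCluster hy), hreach⟩

/-- **An old `J`-site off the domain stays** (rerouting). [cite: GeorgiiHiguchi2000, Lemma 5.2 (proof: "determined from outside")] -/
theorem mem_pinJ_of_agree_of_mem_pinJ (hagree : ∀ v, v ∉ pinDom m L ω → ω' v = ω v) {z : Site 2}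
    (hz : z ∉ pinDom m L ω) (hzJ : z ∈ pinJ m ω) : z ∈ pinJ m ω' := by
  classical
  set C := siteCluster zdStarGraph (pinU m ω) z with hC
  have hzU : z ∈ pinU m ω := mem_pinU_of_mem_pinJ hzJ
  have hzU' : z ∈ pinU m ω' := (pinU_agree hagree hz).2 hzU
  have hinf : (C \ ↑(pinDom m L ω)).Infinite := Set.Infinite.sdiff hzJ (finite_toSet _)
  refine Set.Infinite.mono (fun y hy => ?_) hinf
  obtain ⟨hyC, hyD⟩ := hy
  have hyD' : y ∉ pinDom m L ω := fun h => hyD (Finset.mem_coe.2 h)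
  obtain ⟨W, hW⟩ := exists_walk_in_siteCluster ((mem_siteCluster_self_iff _ _ _).2 hzU) hyC
  obtain ⟨W', hW'⟩ := reroute (m := m) (L := L) (ω := ω) (pinDom m L ω).card W ⟨pinDom m L ω, le_rfl, fun v _ hv => hv⟩
    (fun v hv => mem_pinJ_of_mem_cluster hzJ (hW v hv)) hz hyD'
  have hreach : (siteOpenGraph zdStarGraph (pinU m ω')).Reachable z y :=
    reachable_siteOpenGraph_of_walk W' fun v hv => (pinU_agree hagree (hW' v hv).2).2 (mem_pinU_of_mem_pinJ (hW' v hv).1)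
  exact ⟨hzU', (pinU_agree hagree hyD').2 (mem_of_mem_siteCluster hyC), hreach⟩

/-- `J` agrees off the domain. [cite: GeorgiiHiguchi2000, Lemma 5.2 (proof)] -/
theorem pinJ_agree (hagree : ∀ v, v ∉ pinDom m L ω → ω' v = ω v) {z : Site 2} (hz : z ∉ pinDom m L ω) :
    z ∈ pinJ m ω' ↔ z ∈ pinJ m ω :=
  ⟨mem_pinJ_of_mem_pinJ_of_agree hagree hz, mem_pinJ_of_agree_of_mem_pinJ hagree hz⟩

/-- The blocking set agrees off the domain. [folklore] -/
theorem pinKsym_agree (hagree : ∀ v, v ∉ pinDom m L ω → ω' v = ω v) {z : Site 2} (hz : z ∉ pinDom m L ω) :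
    z ∈ pinKsym m L ω' ↔ z ∈ pinKsym m L ω := by
  have hz' : Rf z ∉ pinDom m L ω := fun h => hz (pinDom_Rf_iff.1 h)
  simp only [pinKsym, pinK, Set.mem_setOf_eq, pinJ_agree hagree hz, pinJ_agree hagree hz']

/-- Passability agrees off the domain. [folklore] -/
theorem pinPass_agree (hagree : ∀ v, v ∉ pinDom m L ω → ω' v = ω v) {z : Site 2} (hz : z ∉ pinDom m L ω) :
    z ∈ pinPass m L ω' ↔ z ∈ pinPass m L ω := by
  simp only [pinPass, Set.mem_setOf_eq, pinKsym_agree hagree hz]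

/-- **Reaching walks of `ω'` never enter the domain of `ω`** and consist of `ω`-reachable sites. [folklore] -/
theorem reachWalk_avoids (hagree : ∀ v, v ∉ pinDom m L ω → ω' v = ω v) :
    ∀ {y z : Site 2} (w : (zdGraph 2).Walk y z), y ∈ pinReach m L ω → y ∉ pinDom m L ω →
      (∀ v ∈ w.support, v ∈ pinPass m L ω') → ∀ v ∈ w.support, v ∉ pinDom m L ω ∧ v ∈ pinReach m L ω := by
  intro y z w
  induction w with
  | nil => intro hy hyD _ v hv; rw [Walk.support_nil, List.mem_singleton] at hv; exact hv ▸ ⟨hyD, hy⟩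
  | cons hadj p ih =>
    rename_i u v' t
    intro hu huD hp x hx
    have hv'D : v' ∉ pinDom m L ω := fun h => not_mem_pinReach_of_adj_pinDom h hadj.symm hu
    have hv'P : v' ∈ pinPass m L ω := (pinPass_agree hagree hv'D).1 (hp v' (by simp))
    have hv'R : v' ∈ pinReach m L ω := mem_pinReach_of_adj hv'P hu hadj.symm
    rw [Walk.support_cons, List.mem_cons] at hx
    rcases hx with rfl | hx
    · exact ⟨huD, hu⟩
    · exact ih hv'R hv'D (fun w hw => hp w (by simp [hw])) x hx

/-- Reachability agrees. [folklore] -/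
theorem pinReach_agree (hagree : ∀ v, v ∉ pinDom m L ω → ω' v = ω v) {z : Site 2} :
    z ∈ pinReach m L ω' ↔ z ∈ pinReach m L ω := by
  constructor
  · rintro ⟨y, hy, w, hw⟩
    have hyR : y ∈ pinReach m L ω := mem_pinReach_of_mem_pinOut hy
    exact (reachWalk_avoids hagree w hyR (fun h => (mem_pinDom_iff.1 h).1 hyR) hw z (Walk.end_mem_support w)).2
  · rintro ⟨y, hy, w, hw⟩
    refine ⟨y, hy, w, fun v hv => (pinPass_agree hagree fun h => ?_).2 (hw v hv)⟩
    exact (mem_pinDom_iff.1 h).1 (mem_pinReach_of_mem_support hy w hw hv)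

/-- The crust agrees. [folklore] -/
theorem pinCrust_agree (hagree : ∀ v, v ∉ pinDom m L ω → ω' v = ω v) {k : Site 2} :
    k ∈ pinCrust m L ω' ↔ k ∈ pinCrust m L ω := by
  constructor
  · rintro ⟨hkP, y, hy, hky⟩
    have hyR : y ∈ pinReach m L ω := (pinReach_agree hagree).1 hy
    have hkD : k ∉ pinDom m L ω := fun h => not_mem_pinReach_of_adj_pinDom h hky hyR
    exact ⟨fun h => hkP ((pinPass_agree hagree hkD).2 h), y, hyR, hky⟩
  · rintro ⟨hkP, y, hy, hky⟩
    have hkD : k ∉ pinDom m L ω := not_mem_pinDom_of_mem_pinCrust ⟨hkP, y, hy, hky⟩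
    exact ⟨fun h => hkP ((pinPass_agree hagree hkD).1 h), y, (pinReach_agree hagree).2 hy, hky⟩

/-- **The pinning domain is determined from outside**: configurations agreeing off the domain have
the same domain. [cite: GeorgiiHiguchi2000, Lemma 5.2 (proof: "By maximality, `Γ` is determined from outside")] -/
theorem pinDom_eq_of_agree (hagree : ∀ v, v ∉ pinDom m L ω → ω' v = ω v) : pinDom m L ω' = pinDom m L ω := by
  ext z
  rw [mem_pinDom_iff, mem_pinDom_iff, pinReach_agree hagree, pinCrust_agree hagree]

end Agree

end Literature.Probability.LatticeModels
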